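import Mathlib.CategoryTheory.Equivalence
import Mathlib.Algebra.Order.Floor.Defs
import Mathlib.Algebra.Order.Floor.Ring
import Mathlib.Data.Rat.Floor
import Mathlib.Data.PNat.Basic
import Literature.AlgebraicGeometry.Frobenioids.BaseCategoryTheoreticity
import HarnessLib

/-!
# Frobenioids I, Thm. 3.4: an obstruction to the `1`-uniqueness conjunct of `OneUniqueSquare`, and the
# thin «rational-degree» category with its floor endofunctor

Mochizuki, *The geometry of Frobenioids I: the general theory*, Kyushu J. Math. **62** (2008), Thm. 3.4 p. 62
("there exists a 1-unique functor … that fits into a 1-commutative diagram"), §0 p. 15 (`1`-commutative diagrams)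
[cite: MochizukiFrdI2008, Thm. 3.4 (iii) p.62].  The cell types «`1`-unique» as the third conjunct of
`PreFrobenioidData.OneUniqueSquare T L R B` (`BaseCategoryTheoreticity.lean`, seat abc-iut-L1-t3): EVERY functor `B'`
with `T ⋙ R ≅ L ⋙ B'` is isomorphic to `B`.  abc-iut GAP-LEDGER row G-L1d8-2 asks whether this bare reading holds for
the perfection square `Ψ^pf` of Thm. 3.4 (iii) when `C₁ → C₁^pf` is not essentially surjective.

This file is the STRUCTURE-FREE half of the kernel answer (negative):

* `not_oneUniqueSquare_of_endo` — if the target `Y₂` of the right vertical arrow `R : X₂ ⥤ Y₂` carries an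
  endofunctor `E` with `R ⋙ E ≅ R` and an object `m` with `E m ≇ m`, then NO square `(T, L, R, B)` is `1`-unique
  (for `B' := B ⋙ E` also fits, so `E ≅ 𝟭`, contradiction); `not_oneUniqueSquare_of_transport` — the same with
  `E`, `m` given on an equivalent category `V : Y₂ ⥤ M`.
* `RatDeg` — the thin category with objects the rationals and `Hom(q, r) = {d ∈ ℕ_{≥1} | d·q ≤ r}` (degrees
  multiply), its endofunctor `RatDeg.floor` (`q ↦ ⌊q⌋`, identity on degrees) and the facts that `floor` fixes
  the integral objects while `⌊1/2⌋ = 0 ≇ 1/2`.  The companion file `PerfectionSquareNotOneUnique.lean` shows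
  that the perfection of the model Frobenioid of `(ℤ_{≥0}, 0)` over the one-morphism base is equivalent to
  `RatDeg` compatibly with degrees, with `C → C^pf` landing in the integral objects.

HONEST FRAMING: pure category theory / arithmetic of `ℚ`; nothing here bears on [IUTchIII] Cor. 3.12; it records
that the cell's literal typing of «1-unique» is stronger than what print proves (print p. 64 ll. 26–28 derives
uniqueness only among structure-compatible functors).
-/

namespace Literature.AlgebraicGeometry.Frobenioids

open CategoryTheory

universe v₁ v₂ v₃ v₄ v₅ u₁ u₂ u₃ u₄ u₅

/-! ### The obstruction -/

section Obstruction

variable {X₁ : Type u₁} [Category.{v₁} X₁] {X₂ : Type u₂} [Category.{v₂} X₂]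
  {Y₁ : Type u₃} [Category.{v₃} Y₁] {Y₂ : Type u₄} [Category.{v₄} Y₂] {M : Type u₅} [Category.{v₅} M]

/-- If `B ⋙ E ≅ B` for an equivalence `B`, then `E` fixes every object up to isomorphism. [folklore] -/
private theorem nonempty_iso_of_comp_iso_self {B : Y₁ ⥤ Y₂} [B.IsEquivalence] {E : Y₂ ⥤ Y₂} (j : B ⋙ E ≅ B)
    (y : Y₂) : Nonempty (E.obj y ≅ y) := by
  let eB := B.asEquivalence
  let c : B.obj (eB.inverse.obj y) ≅ y := eB.counitIso.app y
  exact ⟨E.mapIso c.symm ≪≫ j.app (eB.inverse.obj y) ≪≫ c⟩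

/-- **Obstruction to `1`-uniqueness.** If the target of `R : X₂ ⥤ Y₂` carries an endofunctor `E` with
`R ⋙ E ≅ R` and an object `m` with `E m ≇ m`, then no square with right vertical arrow `R` is `1`-unique in the
sense of `PreFrobenioidData.OneUniqueSquare` (FrdI Thm. 3.4, «1-unique functor … 1-commutative diagram», as typed
by the cell). [cite: MochizukiFrdI2008, Thm. 3.4 (iii) p.62] -/
theorem not_oneUniqueSquare_of_endo (R : X₂ ⥤ Y₂) (E : Y₂ ⥤ Y₂) (e : R ⋙ E ≅ R) (m : Y₂)
    (hm : IsEmpty (E.obj m ≅ m)) (T : X₁ ⥤ X₂) (L : X₁ ⥤ Y₁) (B : Y₁ ⥤ Y₂) :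
    ¬ PreFrobenioidData.OneUniqueSquare T L R B := by
  rintro ⟨hB, ⟨i⟩, huniq⟩
  -- `B ⋙ E` also fits into the square
  have hfit : OneCommutes T R L (B ⋙ E) :=
    ⟨(Functor.isoWhiskerLeft T e).symm ≪≫ (Functor.associator T R E).symm ≪≫ Functor.isoWhiskerRight i E ≪≫
      Functor.associator L B E⟩
  obtain ⟨j⟩ := huniq (B ⋙ E) hfit
  exact hm.false (nonempty_iso_of_comp_iso_self j m).some

/-- **Obstruction to `1`-uniqueness, transported form.** The same conclusion when the endofunctor `E` and the
object `m` live on a category `M` equivalent to the target via `V : Y₂ ⥤ M`, with `R ⋙ V ⋙ E ≅ R ⋙ V`.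
[cite: MochizukiFrdI2008, Thm. 3.4 (iii) p.62] -/
theorem not_oneUniqueSquare_of_transport (R : X₂ ⥤ Y₂) (V : Y₂ ⥤ M) [V.IsEquivalence] (E : M ⥤ M)
    (e : R ⋙ V ⋙ E ≅ R ⋙ V) (m : M) (hm : IsEmpty (E.obj m ≅ m)) (T : X₁ ⥤ X₂) (L : X₁ ⥤ Y₁) (B : Y₁ ⥤ Y₂) :
    ¬ PreFrobenioidData.OneUniqueSquare T L R B := by
  let eV := V.asEquivalence
  -- the transported endofunctor `E' := V ⋙ E ⋙ V⁻¹`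
  let E' : Y₂ ⥤ Y₂ := V ⋙ E ⋙ eV.inverse
  have e' : R ⋙ E' ≅ R :=
    (Functor.associator R V (E ⋙ eV.inverse)).symm ≪≫ (Functor.associator (R ⋙ V) E eV.inverse).symm ≪≫
      Functor.isoWhiskerRight ((Functor.associator R V E) ≪≫ e) eV.inverse ≪≫ Functor.associator R V eV.inverse ≪≫
      Functor.isoWhiskerLeft R eV.unitIso.symm ≪≫ Functor.rightUnitor R
  refine not_oneUniqueSquare_of_endo R E' e' (eV.inverse.obj m) ⟨fun k => hm.false ?_⟩ T L B
  -- `k : V⁻¹ (E (V (V⁻¹ m))) ≅ V⁻¹ m`; cancel `V⁻¹` and `V V⁻¹ ≅ 𝟭`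
  have k' : E.obj (V.obj (eV.inverse.obj m)) ≅ m := eV.fullyFaithfulInverse.preimageIso k
  exact E.mapIso (eV.counitIso.app m).symm ≪≫ k'

end Obstruction

/-! ### The thin rational-degree category -/

/-- The objects of the «rational-degree» category: rational numbers (the rational degree `deg(A)/n` of an
object `(A, n)` of the perfection of the model Frobenioid of `(ℤ_{≥0}, 0)` over the one-morphism base).
[cite: MochizukiFrdI2008, Def. 3.1 (iii) p.57] -/
@[ext] structure RatDeg : Type where
  /-- the rational degree -/
  q : ℚ

namespace RatDeg

/-- `Hom(q, r) = {d ∈ ℕ_{≥1} | d·q ≤ r}`, composition multiplies degrees. [cite: MochizukiFrdI2008, Thm. 5.2 (i) p.100] -/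
instance instCategory : Category RatDeg where
  Hom X Y := {d : ℕ+ // ((d : ℕ) : ℚ) * X.q ≤ Y.q}
  id X := ⟨1, by rw [PNat.one_coe, Nat.cast_one, one_mul]⟩
  comp {X Y Z} f g := ⟨g.1 * f.1, by
    have hg : (0 : ℚ) ≤ ((g.1 : ℕ) : ℚ) := Nat.cast_nonneg _
    calc (((g.1 * f.1 : ℕ+) : ℕ) : ℚ) * X.q = ((g.1 : ℕ) : ℚ) * (((f.1 : ℕ) : ℚ) * X.q) := by
          rw [PNat.mul_coe, Nat.cast_mul, mul_assoc]
      _ ≤ ((g.1 : ℕ) : ℚ) * Y.q := mul_le_mul_of_nonneg_left f.2 hg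
      _ ≤ Z.q := g.2⟩
  id_comp f := Subtype.ext (mul_one _)
  comp_id f := Subtype.ext (one_mul _)
  assoc f g h := Subtype.ext (mul_assoc _ _ _).symm

/-- The degree of an arrow. [cite: MochizukiFrdI2008, Thm. 5.2 (i) p.100] -/
abbrev deg {X Y : RatDeg} (f : X ⟶ Y) : ℕ+ := f.1

/-- Arrows are determined by their degree. [cite: MochizukiFrdI2008, Thm. 5.2 (i) p.100] -/
theorem hom_ext {X Y : RatDeg} {f g : X ⟶ Y} (h : deg f = deg g) : f = g := Subtype.ext h

/-- The defining inequality of an arrow. [cite: MochizukiFrdI2008, Thm. 5.2 (i) p.100] -/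
theorem deg_mul_le {X Y : RatDeg} (f : X ⟶ Y) : ((deg f : ℕ) : ℚ) * X.q ≤ Y.q := f.2

/-- Degree of the identity. [cite: MochizukiFrdI2008, Thm. 5.2 (i) p.100] -/
@[simp] theorem deg_id (X : RatDeg) : deg (𝟙 X) = 1 := rfl

/-- Degree of a composite. [cite: MochizukiFrdI2008, Thm. 5.2 (i) p.100] -/
@[simp] theorem deg_comp {X Y Z : RatDeg} (f : X ⟶ Y) (g : Y ⟶ Z) : deg (f ≫ g) = deg g * deg f := rfl

/-- The arrow of degree `d` when `d·q ≤ r`. [cite: MochizukiFrdI2008, Thm. 5.2 (i) p.100] -/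
def homMk (X Y : RatDeg) (d : ℕ+) (h : ((d : ℕ) : ℚ) * X.q ≤ Y.q) : X ⟶ Y := ⟨d, h⟩

/-- Degree of `homMk`. [cite: MochizukiFrdI2008, Thm. 5.2 (i) p.100] -/
@[simp] theorem deg_homMk (X Y : RatDeg) (d : ℕ+) (h : ((d : ℕ) : ℚ) * X.q ≤ Y.q) : deg (homMk X Y d h) = d := rfl

/-- Objects with the same rational degree are isomorphic (by degree-one arrows). [cite: MochizukiFrdI2008, Thm. 5.2 (i) p.100] -/
def isoOfEq {X Y : RatDeg} (h : X.q = Y.q) : X ≅ Y where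
  hom := homMk X Y 1 (by rw [PNat.one_coe, Nat.cast_one, one_mul, h])
  inv := homMk Y X 1 (by rw [PNat.one_coe, Nat.cast_one, one_mul, h])
  hom_inv_id := hom_ext rfl
  inv_hom_id := hom_ext rfl

/-- An isomorphism has degree one. [cite: MochizukiFrdI2008, Thm. 5.2 (i) p.100] -/
theorem deg_eq_one_of_iso {X Y : RatDeg} (i : X ≅ Y) : deg i.hom = 1 := by
  have h : deg i.inv * deg i.hom = 1 := by rw [← deg_comp, i.hom_inv_id, deg_id]
  have h' : ((deg i.inv : ℕ+) : ℕ) * ((deg i.hom : ℕ+) : ℕ) = 1 := by rw [← PNat.mul_coe, h, PNat.one_coe]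
  exact PNat.coe_injective ((Nat.eq_one_of_mul_eq_one_left h').trans PNat.one_coe.symm)

/-- Isomorphic objects have the same rational degree. [cite: MochizukiFrdI2008, Thm. 5.2 (i) p.100] -/
theorem q_eq_of_iso {X Y : RatDeg} (i : X ≅ Y) : X.q = Y.q := by
  have h₁ := deg_mul_le i.hom
  have h₂ := deg_mul_le i.inv
  have h₃ := deg_eq_one_of_iso i.symm
  rw [Iso.symm_hom] at h₃
  rw [deg_eq_one_of_iso i, PNat.one_coe, Nat.cast_one, one_mul] at h₁
  rw [h₃, PNat.one_coe, Nat.cast_one, one_mul] at h₂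
  exact le_antisymm h₁ h₂

/-! ### The floor endofunctor -/

/-- `d·⌊q⌋ ≤ ⌊r⌋` whenever `d·q ≤ r` (`d ≥ 0` an integer). [folklore] -/
private theorem floor_ineq {d : ℕ} {q r : ℚ} (h : (d : ℚ) * q ≤ r) : (d : ℚ) * (⌊q⌋ : ℚ) ≤ (⌊r⌋ : ℚ) := by
  have h1 : ((d : ℤ) * ⌊q⌋ : ℤ) ≤ ⌊r⌋ := by
    rw [Int.le_floor, Int.cast_mul, Int.cast_natCast]
    exact (mul_le_mul_of_nonneg_left (Int.floor_le q) (Nat.cast_nonneg d)).trans h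
  exact_mod_cast h1

/-- **The floor endofunctor** `q ↦ ⌊q⌋`, identity on degrees. [cite: MochizukiFrdI2008, Def. 3.1 (iii) p.57] -/
def floor : RatDeg ⥤ RatDeg where
  obj X := ⟨((⌊X.q⌋ : ℤ) : ℚ)⟩
  map f := ⟨deg f, floor_ineq (deg_mul_le f)⟩
  map_id _ := hom_ext rfl
  map_comp _ _ := hom_ext rfl

/-- `floor` is the identity on degrees. [cite: MochizukiFrdI2008, Def. 3.1 (iii) p.57] -/
@[simp] theorem deg_floor_map {X Y : RatDeg} (f : X ⟶ Y) : deg (floor.map f) = deg f := rfl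

/-- `floor` on objects. [cite: MochizukiFrdI2008, Def. 3.1 (iii) p.57] -/
@[simp] theorem floor_obj_q (X : RatDeg) : (floor.obj X).q = ((⌊X.q⌋ : ℤ) : ℚ) := rfl

/-- `floor` fixes the integral objects on the nose. [cite: MochizukiFrdI2008, Def. 3.1 (iii) p.57] -/
theorem floor_obj_of_int (X : RatDeg) (k : ℤ) (hk : X.q = (k : ℚ)) : floor.obj X = X := by
  ext
  rw [floor_obj_q, hk, Int.floor_intCast]

/-- The object of rational degree `1/2`. [cite: MochizukiFrdI2008, Def. 3.1 (iii) p.57] -/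
def half : RatDeg := ⟨1 / 2⟩

/-- `⌊1/2⌋ = 0`. [folklore] -/
private theorem floor_obj_half : floor.obj half = ⟨0⟩ := by
  ext
  rw [floor_obj_q]
  have : ⌊(half.q)⌋ = 0 := by
    rw [Int.floor_eq_iff]
    exact ⟨by norm_num [half], by norm_num [half]⟩
  rw [this, Int.cast_zero]

/-- **`⌊1/2⌋ ≇ 1/2`** in the rational-degree category (an isomorphism would have degree one and force
`1/2 ≤ 0`). [cite: MochizukiFrdI2008, Def. 3.1 (iii) p.57] -/
theorem isEmpty_floor_half_iso : IsEmpty (floor.obj half ≅ half) := by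
  refine ⟨fun i => ?_⟩
  have h := q_eq_of_iso i
  rw [floor_obj_half] at h
  norm_num [half] at h

end RatDeg

end Literature.AlgebraicGeometry.Frobenioids
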